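import Literature.Probability.RandomPlanarGeometry.RestrictionDensityLoewner
import Literature.Probability.RandomPlanarGeometry.SlitHulls
import Literature.Probability.RandomPlanarGeometry.PlusHullExtension
import HarnessLib

/-!
# The slits `β[0, u]` of the boundary path of a smooth `+`-hull

G. F. Lawler, O. Schramm, W. Werner, *Conformal restriction: the chordal case*, J. Amer. Math.
Soc. **16** (2003), proof of Lemma 3.5, p. 13: for the hull `E_δ` bounded by the simple path
`β : [0, s] → ℍ̄` (`β(0), β(s) ∈ ℝ`) the argument runs through the hulls `β[0, t]`, `t < s`
("`g_t := g_{β[0,t]}`, `Φ_t := Φ_{β[0,t]}`"), which increase to `E_δ` and converge to it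
("`Φ_s(z) = Φ_{E_δ}`"). This proof-only file records the elementary facts about these slits for
an arc hull `A` of the tree (`IsArcHull A ∧ IsPlusHull A`, boundary path `γ : [0, 1] → ℍ̄`,
`ℍ ∩ ∂A = γ(0, 1)`), in the form consumed by the kernel theorem
`IsPlusHull.tendstoLocallyUniformlyOn_extMap_of_frontier` (`HullKernelLimit`):

* `IsArcHull.image_Icc_subset` — `γ[0, 1] ⊆ A`; `IsArcHull.re_apply_zero_pos` — `γ(0) > 0`;
* `IsArcHull.isPlusHull_slit` — `γ[0, u] ∈ 𝒬₊` for `0 < u < 1` (`SlitHulls`);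
* `realTrace_slit`, `leftPt_slit`, `rightPt_slit`, `realFill_slit` — the only real point of a slit
  is `γ(0)`, so `realFill (γ[0, u]) = γ[0, u]`;
* `IsArcHull.plusDomain_subset_plusDomain_slit` — `Ω_A ⊆ Ω_{γ[0,u]}`
  (`A_u ∪ Ā_u ∪ {γ 0} ⊆ A ∪ Ā ∪ [x₀, x₁]`);
* `IsArcHull.eventually_mem_slit` — every point of `ℍ ∩ ∂A` lies in `γ[0, u_n]` for all large
  `n` whenever `u_n → 1`.
-/

noncomputable section

open Set Filter Metric Complex Bornology
open _root_.Topology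
open UpperHalfPlane (upperHalfPlaneSet isOpen_upperHalfPlaneSet)
open scoped ComplexConjugate

namespace Literature.Probability.RandomPlanarGeometry

/-! ### Real points of a slit -/

section SlitReal

variable {γ : ℝ → ℂ} {u : ℝ}

/-- **The only real point of a slit `γ[0, u]` (`γ(0, u] ⊆ ℍ`) is `γ(0)`.** [folklore] -/
theorem realTrace_slit (hu : 0 ≤ u) (h0 : (γ 0).im = 0) (hpos : ∀ t ∈ Ioc 0 u, 0 < (γ t).im) :
    realTrace (γ '' Icc 0 u) = {(γ 0).re} := by
  ext x
  simp only [mem_realTrace, mem_singleton_iff]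
  constructor
  · rintro ⟨t, ht, htx⟩
    rcases ht.1.lt_or_eq with hlt | heq
    · have := hpos t ⟨hlt, ht.2⟩
      rw [htx, ofReal_im] at this
      exact absurd this (lt_irrefl 0)
    · rw [← heq] at htx
      have := congrArg Complex.re htx
      simpa using this.symm
  · intro hx
    refine ⟨0, ⟨le_rfl, hu⟩, ?_⟩
    rw [hx]
    exact Complex.ext (by simp) (by simp [h0])

/-- `leftPt (γ[0, u]) = γ(0)`. [folklore] -/
theorem leftPt_slit (hu : 0 ≤ u) (h0 : (γ 0).im = 0) (hpos : ∀ t ∈ Ioc 0 u, 0 < (γ t).im) :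
    leftPt (γ '' Icc 0 u) = (γ 0).re := by
  rw [leftPt, realTrace_slit hu h0 hpos, csInf_singleton]

/-- `rightPt (γ[0, u]) = γ(0)`. [folklore] -/
theorem rightPt_slit (hu : 0 ≤ u) (h0 : (γ 0).im = 0) (hpos : ∀ t ∈ Ioc 0 u, 0 < (γ t).im) :
    rightPt (γ '' Icc 0 u) = (γ 0).re := by
  rw [rightPt, realTrace_slit hu h0 hpos, csSup_singleton]

/-- **`realFill (γ[0, u]) = γ[0, u]`**: a slit has no real gap to fill. [folklore] -/
theorem realFill_slit (hu : 0 ≤ u) (h0 : (γ 0).im = 0) (hpos : ∀ t ∈ Ioc 0 u, 0 < (γ t).im) :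
    realFill (γ '' Icc 0 u) = γ '' Icc 0 u := by
  refine Subset.antisymm ?_ (subset_realFill _)
  rw [realFill_eq, leftPt_slit hu h0 hpos, rightPt_slit hu h0 hpos, Icc_self, image_singleton]
  refine union_subset subset_rfl (singleton_subset_iff.2 ⟨0, ⟨le_rfl, hu⟩, ?_⟩)
  exact Complex.ext (by simp) (by simp [h0])

/-- The symmetrisation `K` of a slit is `γ[0, u] ∪ conj(γ[0, u])` (the real segment
`[leftPt, rightPt]` is the point `γ(0)`), hence contained in the symmetrisation of any `+`-hull
`A ⊇ γ[0, u]`. [folklore] -/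
theorem plusCompact_slit_subset {A : Set ℂ} (hu : 0 ≤ u) (h0 : (γ 0).im = 0)
    (hpos : ∀ t ∈ Ioc 0 u, 0 < (γ t).im) (hsub : γ '' Icc 0 u ⊆ A) :
    plusCompact (γ '' Icc 0 u) ⊆ plusCompact A := by
  have h0A : γ 0 ∈ A := hsub ⟨0, ⟨le_rfl, hu⟩, rfl⟩
  rintro z ((hz | hz) | hz)
  · exact Or.inl (Or.inl (hsub hz))
  · exact Or.inl (Or.inr (hsub hz))
  · -- the degenerate segment `{γ 0}`
    change z ∈ realSeg (leftPt (γ '' Icc 0 u)) (rightPt (γ '' Icc 0 u)) at hz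
    rw [leftPt_slit hu h0 hpos, rightPt_slit hu h0 hpos, mem_realSeg_iff, uIcc_self,
      mem_singleton_iff] at hz
    have hzeq : z = γ 0 := Complex.ext hz.2 (by rw [hz.1, h0])
    rw [hzeq]
    exact Or.inl (Or.inl h0A)

end SlitReal

/-! ### Slits of the boundary path of an arc hull -/

section ArcSlits

variable {A : Set ℂ} (hA : IsArcHull A) (hAp : IsPlusHull A) {γ : ℝ → ℂ}
  (hγc : ContinuousOn γ (Icc 0 1)) (hγi : InjOn γ (Icc 0 1)) (h0 : (γ 0).im = 0) (h1 : (γ 1).im = 0)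
  (hH : ∀ t ∈ Ioo (0 : ℝ) 1, 0 < (γ t).im) (hfr : upperHalfPlaneSet ∩ frontier A = γ '' Ioo 0 1)
include hA hγc hfr

/-- The endpoint `γ(1)` of the boundary arc lies in the hull (as `γ(0)` does,
`IsArcHull.apply_zero_mem`). [folklore] -/
theorem IsArcHull.apply_one_mem : γ 1 ∈ A := by
  have hc : ContinuousWithinAt γ (Ioo 0 1) 1 := (hγc 1 ⟨zero_le_one, le_rfl⟩).mono Ioo_subset_Icc_self
  have hcl : (1 : ℝ) ∈ closure (Ioo (0 : ℝ) 1) := by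
    rw [closure_Ioo zero_ne_one]; exact ⟨zero_le_one, le_rfl⟩
  have hmem := hc.mem_closure_image hcl
  rw [← hfr] at hmem
  have h2 : closure (upperHalfPlaneSet ∩ frontier A) ⊆ A :=
    (closure_mono inter_subset_right).trans
      (by rw [isClosed_frontier.closure_eq]; exact frontier_subset_iff_isClosed.2 hA.1.isClosed)
  exact h2 hmem

/-- **`γ[0, 1] ⊆ A`**: the boundary arc, endpoints included, lies in the (closed) hull. [folklore] -/
theorem IsArcHull.image_Icc_subset : γ '' Icc 0 1 ⊆ A := by
  rintro _ ⟨t, ht, rfl⟩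
  rcases ht.1.lt_or_eq with hlt | heq
  · rcases ht.2.lt_or_eq with hlt' | heq'
    · have : γ t ∈ upperHalfPlaneSet ∩ frontier A := by rw [hfr]; exact ⟨t, ⟨hlt, hlt'⟩, rfl⟩
      exact frontier_subset_iff_isClosed.2 hA.1.isClosed this.2
    · rw [heq']; exact hA.apply_one_mem hγc hfr
  · rw [← heq]; exact hA.apply_zero_mem hγc hfr

include hAp h0 in
/-- `γ(0)` is a positive real (`A ∈ 𝒬₊`). [folklore] -/
theorem IsArcHull.re_apply_zero_pos : 0 < (γ 0).re := by
  have h : ((γ 0).re : ℂ) = γ 0 := Complex.ext (by simp) (by simp [h0])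
  exact hAp.2 _ (by rw [h]; exact hA.apply_zero_mem hγc hfr)

omit hA hγc hfr in
include hH in
/-- Points of `γ(0, u]`, `u < 1`, are in `ℍ`. [folklore] -/
theorem IsArcHull.im_pos_of_mem_Ioc {u : ℝ} (hu1 : u < 1) {t : ℝ} (ht : t ∈ Ioc 0 u) :
    0 < (γ t).im :=
  hH t ⟨ht.1, lt_of_le_of_lt ht.2 hu1⟩

include hAp hγi h0 hH in
/-- **The slits `γ[0, u]`, `0 < u < 1`, are `+`-hulls** (`isPlusHull_slit`).
[cite: LawlerSchrammWerner2003Restriction, proof of Lemma 3.5 (p. 13), the hulls β[0,t]] -/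
theorem IsArcHull.isPlusHull_slit {u : ℝ} (hu0 : 0 < u) (hu1 : u < 1) : IsPlusHull (γ '' Icc 0 u) :=
  Literature.Probability.RandomPlanarGeometry.isPlusHull_slit hu0
    (hγc.mono (Icc_subset_Icc_right hu1.le)) (hγi.mono (Icc_subset_Icc_right hu1.le)) h0
    (hA.re_apply_zero_pos hAp hγc h0 hfr) fun _ ht ↦ IsArcHull.im_pos_of_mem_Ioc hH hu1 ht

/-- The slits lie in the hull: `γ[0, u] ⊆ A` for `u ≤ 1`. [folklore] -/
theorem IsArcHull.slit_subset {u : ℝ} (hu1 : u ≤ 1) : γ '' Icc 0 u ⊆ A :=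
  (image_mono (Icc_subset_Icc_right hu1)).trans (hA.image_Icc_subset hγc hfr)

include h0 hH in
/-- **`Ω_A ⊆ Ω_{γ[0,u]}`**: the symmetric domain of the hull is contained in that of each of its
slits (hypothesis `hdom` of the kernel theorem). [folklore] -/
theorem IsArcHull.plusDomain_subset_plusDomain_slit {u : ℝ} (hu0 : 0 ≤ u) (hu1 : u < 1) :
    plusDomain A ⊆ plusDomain (γ '' Icc 0 u) := by
  rw [plusDomain_eq_compl, plusDomain_eq_compl, compl_subset_compl]
  exact plusCompact_slit_subset hu0 h0 (fun _ ht ↦ IsArcHull.im_pos_of_mem_Ioc hH hu1 ht)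
    (hA.slit_subset hγc hfr hu1.le)

include h0 hH in
/-- `realFill (γ[0, u]) = γ[0, u] ⊆ realFill A`. [folklore] -/
theorem IsArcHull.realFill_slit_subset {u : ℝ} (hu0 : 0 ≤ u) (hu1 : u < 1) :
    realFill (γ '' Icc 0 u) ⊆ realFill A := by
  rw [realFill_slit hu0 h0 (fun _ ht ↦ IsArcHull.im_pos_of_mem_Ioc hH hu1 ht)]
  exact (hA.slit_subset hγc hfr hu1.le).trans (subset_realFill A)

omit hA hγc in
/-- **Exhaustion of `ℍ ∩ ∂A` by the slits**: if `u_n → 1` then every point of `ℍ ∩ ∂A = γ(0, 1)`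
lies in `γ[0, u_n]` for all large `n` (hypothesis `hfr` of the kernel theorem). [folklore] -/
theorem IsArcHull.eventually_mem_slit {v : ℕ → ℝ} (hv : Tendsto v atTop (𝓝 1)) {z : ℂ}
    (hz : z ∈ upperHalfPlaneSet ∩ frontier A) : ∀ᶠ n in atTop, z ∈ γ '' Icc 0 (v n) := by
  rw [hfr] at hz
  obtain ⟨t, ht, rfl⟩ := hz
  filter_upwards [hv.eventually (eventually_gt_nhds ht.2)] with n hn
  exact ⟨t, ⟨ht.1.le, hn.le⟩, rfl⟩

omit hγc hfr in
/-- All the slits lie in a common disc about the real point `γ(0)`: `A ⊆ B̄(γ(0), r)` for some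
`r > 0` (hence `γ[0, u] ⊆ B̄(γ(0), r)`). [folklore] -/
theorem IsArcHull.exists_subset_closedBall_re_apply_zero :
    ∃ r : ℝ, 0 < r ∧ A ⊆ closedBall (((γ 0).re : ℝ) : ℂ) r := by
  obtain ⟨r, hr, hsub⟩ := hA.1.isCompact.isBounded.subset_closedBall_lt 0 (((γ 0).re : ℝ) : ℂ)
  exact ⟨r, hr, hsub⟩

end ArcSlits

end Literature.Probability.RandomPlanarGeometry
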